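import Summits.AtomisticToContinuum.FouriersLaw.Theses.AffineAnchorRing

/-!
# Line `regime-split` for crux `AnchorKuboFourier` (stmt-AtomisticToContinuum-12455) — the typed decomposition as a registered skeleton

Crux-strategist seat planner-cstrat-stmt-AtomisticToContinuum-12455-r1-0 (BC2 redirect of the RESTATED deciding crux of
route-AtomisticToContinuum-AffineAnchorRing). The crux `AnchorKuboFourier` (ring Green–Kubo Abel means → k ⇒ BLR responses of the
bath-driven anchor → k/T²) is cut into the three regimes every open-system Green–Kubo bridge passes through, the exchange regime in
its two one-sided halves; the four pieces are the registered stubs and the composition `AnchorKuboFourier_of` is PROVED (no sorry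
outside the stubs):

* `stub_anchorOpenKuboAbel` (X1, fixed N): Kundu–Dhar–Narayan open-chain Kubo–Abel identity for the anchor — `c_N` integrable on
  `(0,∞)` and `(N−1)T²D = ∫₀^∞ c_N` (anchor twin of the LANDED `StaticAbelianSqueeze.KuboAbelIdentity`).
* `stub_anchorFixedFrequencyMatching` (X2, fixed Laplace frequency): `N⁻¹(∫e^{-εt}c_N − ∫e^{-εt}C_N) → 0` (open vs ring).
* `stub_anchorNoLateExcess` (X3) / `stub_anchorNoLateDeficit` (X4): `I_N(ε) = ∫₀^∞(1−e^{-εt})c_N ≤ ηN`, resp. `≥ −ηN`, for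
  `ε < ε₀(η)`, `N ≥ N₀` — the two halves (overshoot / deficit) of the `ε ↓ 0 ↔ N → ∞` exchange, on the correlation side.
* `AnchorKuboFourier_of : X1 → X2 → X3 → X4 → AffineAnchorRing.AnchorKuboFourier` — Kubo bookkeeping, the Bochner split
  `∫c_N = ∫e^{-εt}c_N + ∫(1−e^{-εt})c_N`, the crux's OWN ring Green–Kubo hypothesis + X2 for the matching, X3 ∧ X4 for the
  two-sided regularity, and the `ε/3` exchange-of-limits lemma `tendsto_of_regularity_matching_abel` (re-proved here).

The same composition, as a Theorems-ready file, is the evidence `Split.lean` on the crux item (a prover lands it with the glue item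
once the split `route edit --split AnchorKuboFourier --into children.json` is filed; children.json attached as evidence too).
Probes (BC2 (c) / BC3): for each stub, `stub → FouriersLaw`, `stub → AnchorKuboFourier` and both converses FAIL under
`first | exact? | simpa | aesop` (16/16), and `example : stub := by exact?` fails (4/4) — see `Lines/regime-split.md`.
-/

namespace Summit.AtomisticToContinuum.FouriersLaw.Cruxes.AnchorKuboFourier.RegimeSplit

open MeasureTheory Filter Set Topology

/-! ## The four registered stubs (the pieces) -/

/-- **X1 (K_a) — fixed-`N` open-chain Kubo–Abel identity for the bath-driven anchor.** [cite: KunduDharNarayan2009, eq. (LROP)] -/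
theorem stub_anchorOpenKuboAbel :
    ∀ μ γ : ℝ, 0 < μ → 0 < γ → (∀ (N : ℕ) (T_L T_R : ℝ), 0 < T_L → 0 < T_R → ∀ ν ν' : MeasureTheory.Measure (Literature.MathematicalPhysics.KineticTheory.HeatConduction.PhaseSpace N), (Literature.MathematicalPhysics.KineticTheory.HeatConduction.OscillatorChain.mk (fun q => μ * q ^ 4 / 4) (fun r => r ^ 4 / 4) γ).IsSteadyState N T_L T_R ν → (Literature.MathematicalPhysics.KineticTheory.HeatConduction.OscillatorChain.mk (fun q => μ * q ^ 4 / 4) (fun r => r ^ 4 / 4) γ).IsSteadyState N T_L T_R ν' → ν = ν') → ∀ ν : (N : ℕ) → ℝ → ℝ → MeasureTheory.Measure (Literature.MathematicalPhysics.KineticTheory.HeatConduction.PhaseSpace N), (∀ (N : ℕ) (T_L T_R : ℝ), 0 < T_L → 0 < T_R → (Literature.MathematicalPhysics.KineticTheory.HeatConduction.OscillatorChain.mk (fun q => μ * q ^ 4 / 4) (fun r => r ^ 4 / 4) γ).IsSteadyState N T_L T_R (ν N T_L T_R)) → ∀ T : ℝ, 0 < T → ∀ (N : ℕ) (D : ℝ),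 Filter.Tendsto (fun δ : ℝ => (Literature.MathematicalPhysics.KineticTheory.HeatConduction.OscillatorChain.mk (fun q => μ * q ^ 4 / 4) (fun r => r ^ 4 / 4) γ).totalCurrent (ν N (T + δ / 2) (T - δ / 2)) / δ) (nhdsWithin 0 {(0 : ℝ)}ᶜ) (nhds D) → MeasureTheory.IntegrableOn (fun t : ℝ => ∫ z, (∑ i : Fin N, (Literature.MathematicalPhysics.KineticTheory.HeatConduction.OscillatorChain.mk (fun q => μ * q ^ 4 / 4) (fun r => r ^ 4 / 4) γ).bondCurrent N i z) * (∫ y, (∑ i : Fin N, (Literature.MathematicalPhysics.KineticTheory.HeatConduction.OscillatorChain.mk (fun q => μ * q ^ 4 / 4) (fun r => r ^ 4 / 4) γ).bondCurrent N i y) ∂((Literature.MathematicalPhysics.KineticTheory.HeatConduction.OscillatorChain.mk (fun q => μ * q ^ 4 / 4) (fun r => r ^ 4 / 4) γ).transitionKernel N T T (t).toNNReal z)) ∂((Literature.MathematicalPhysics.KineticTheory.HeatConduction.OscillatorChain.mk (fun q => μ * q ^ 4 / 4) (fun r => r ^ 4 / 4) γ).gibbsMeasure N T)) (Set.Ioi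 0) ∧ ((N : ℝ) - 1) * T ^ 2 * D = ∫ t in Set.Ioi (0 : ℝ), ∫ z, (∑ i : Fin N, (Literature.MathematicalPhysics.KineticTheory.HeatConduction.OscillatorChain.mk (fun q => μ * q ^ 4 / 4) (fun r => r ^ 4 / 4) γ).bondCurrent N i z) * (∫ y, (∑ i : Fin N, (Literature.MathematicalPhysics.KineticTheory.HeatConduction.OscillatorChain.mk (fun q => μ * q ^ 4 / 4) (fun r => r ^ 4 / 4) γ).bondCurrent N i y) ∂((Literature.MathematicalPhysics.KineticTheory.HeatConduction.OscillatorChain.mk (fun q => μ * q ^ 4 / 4) (fun r => r ^ 4 / 4) γ).transitionKernel N T T (t).toNNReal z)) ∂((Literature.MathematicalPhysics.KineticTheory.HeatConduction.OscillatorChain.mk (fun q => μ * q ^ 4 / 4) (fun r => r ^ 4 / 4) γ).gibbsMeasure N T) := by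
  sorry

/-- **X2 (M_a) — fixed-Laplace-frequency matching of the ring and open-chain per-site Abel means.** [folklore] -/
theorem stub_anchorFixedFrequencyMatching :
    ∀ (μ γ T : ℝ), 0 < μ → 0 < γ → 0 < T → ∀ H : (N : ℕ) → Literature.MathematicalPhysics.KineticTheory.HeatConduction.PhaseSpace N → ℝ, (∀ N : ℕ, H N = fun x : Literature.MathematicalPhysics.KineticTheory.HeatConduction.PhaseSpace N => (Literature.MathematicalPhysics.KineticTheory.HeatConduction.OscillatorChain.mk (fun q => μ * q ^ 4 / 4) (fun r => r ^ 4 / 4) 0).hamiltonian N x + ∑ i : Fin N, ∑ j : Fin N, if i.val + 1 = N ∧ j.val = 0 ∧ 2 < N then (x.1 j - x.1 i) ^ 4 / 4 else 0) → ∀ J : (N : ℕ) → Literature.MathematicalPhysics.KineticTheory.HeatConduction.PhaseSpace N → ℝ, (∀ N : ℕ, J N = fun x : Literature.MathematicalPhysics.KineticTheory.HeatConduction.PhaseSpace N => (∑ i : Fin N, (Literature.MathematicalPhysics.KineticTheory.HeatConduction.OscillatorChain.mk (fun q => μ * q ^ 4 / 4) (fun r => r ^ 4 / 4) 0).bondCurrent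 N i x) + ∑ i : Fin N, ∑ j : Fin N, if i.val + 1 = N ∧ j.val = 0 ∧ 2 < N then -((x.2 i + x.2 j) / 2 * (x.1 j - x.1 i) ^ 3) else 0) → ∀ Φ : (N : ℕ) → ℝ → Literature.MathematicalPhysics.KineticTheory.HeatConduction.PhaseSpace N → Literature.MathematicalPhysics.KineticTheory.HeatConduction.PhaseSpace N, (∀ N : ℕ, Literature.MathematicalPhysics.KineticTheory.NewtonianFlow.IsFlow (fun (q : Fin N → ℝ) (i : Fin N) => -Literature.MathematicalPhysics.KineticTheory.HeatConduction.partialQ i (H N) (q, fun _ => 0)) (Φ N)) → ∀ ε : ℝ, 0 < ε → Filter.Tendsto (fun N : ℕ => (N : ℝ)⁻¹ * ((∫ t in Set.Ioi (0 : ℝ), Real.exp (-(ε * t)) * ∫ z, (∑ i : Fin N, (Literature.MathematicalPhysics.KineticTheory.HeatConduction.OscillatorChain.mk (fun q => μ * q ^ 4 / 4) (fun r => r ^ 4 / 4) γ).bondCurrent N i z) * (∫ y, (∑ i : Fin N, (Literature.MathematicalPhysics.KineticTheory.HeatConduction.OscillatorChain.mk (fun q => μ * q ^ 4 / 4) (fun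 r => r ^ 4 / 4) γ).bondCurrent N i y) ∂((Literature.MathematicalPhysics.KineticTheory.HeatConduction.OscillatorChain.mk (fun q => μ * q ^ 4 / 4) (fun r => r ^ 4 / 4) γ).transitionKernel N T T (t).toNNReal z)) ∂((Literature.MathematicalPhysics.KineticTheory.HeatConduction.OscillatorChain.mk (fun q => μ * q ^ 4 / 4) (fun r => r ^ 4 / 4) γ).gibbsMeasure N T)) - ∫ t in Set.Ioi (0 : ℝ), Real.exp (-(ε * t)) * ∫ x, J N (Φ N t x) * J N x ∂((MeasureTheory.volume : MeasureTheory.Measure (Literature.MathematicalPhysics.KineticTheory.HeatConduction.PhaseSpace N)).tilted (fun x => -(H N) x / T)))) Filter.atTop (nhds 0) := by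
  sorry

/-- **X3 (R_a⁺) — no late positive excess of the open-chain correlation mass, uniformly in `N`.** [folklore] -/
theorem stub_anchorNoLateExcess :
    ∀ (μ γ T : ℝ), 0 < μ → 0 < γ → 0 < T → ∀ η : ℝ, 0 < η → ∃ ε₀ : ℝ, 0 < ε₀ ∧ ∀ ε : ℝ, 0 < ε → ε < ε₀ → ∃ N₀ : ℕ, ∀ N : ℕ, N₀ ≤ N → (∫ t in Set.Ioi (0 : ℝ), (1 - Real.exp (-(ε * t))) * ∫ z, (∑ i : Fin N, (Literature.MathematicalPhysics.KineticTheory.HeatConduction.OscillatorChain.mk (fun q => μ * q ^ 4 / 4) (fun r => r ^ 4 / 4) γ).bondCurrent N i z) * (∫ y, (∑ i : Fin N, (Literature.MathematicalPhysics.KineticTheory.HeatConduction.OscillatorChain.mk (fun q => μ * q ^ 4 / 4) (fun r => r ^ 4 / 4) γ).bondCurrent N i y) ∂((Literature.MathematicalPhysics.KineticTheory.HeatConduction.OscillatorChain.mk (fun q => μ * q ^ 4 / 4) (fun r => r ^ 4 / 4) γ).transitionKernel N T T (t).toNNReal z)) ∂((Literature.MathematicalPhysics.KineticTheory.HeatConduction.OscillatorChain.mk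 (fun q => μ * q ^ 4 / 4) (fun r => r ^ 4 / 4) γ).gibbsMeasure N T)) ≤ η * N := by
  sorry

/-- **X4 (R_a⁻) — no late deficit of the open-chain correlation mass, uniformly in `N`.** [folklore] -/
theorem stub_anchorNoLateDeficit :
    ∀ (μ γ T : ℝ), 0 < μ → 0 < γ → 0 < T → ∀ η : ℝ, 0 < η → ∃ ε₀ : ℝ, 0 < ε₀ ∧ ∀ ε : ℝ, 0 < ε → ε < ε₀ → ∃ N₀ : ℕ, ∀ N : ℕ, N₀ ≤ N → -(η * N) ≤ ∫ t in Set.Ioi (0 : ℝ), (1 - Real.exp (-(ε * t))) * ∫ z, (∑ i : Fin N, (Literature.MathematicalPhysics.KineticTheory.HeatConduction.OscillatorChain.mk (fun q => μ * q ^ 4 / 4) (fun r => r ^ 4 / 4) γ).bondCurrent N i z) * (∫ y, (∑ i : Fin N, (Literature.MathematicalPhysics.KineticTheory.HeatConduction.OscillatorChain.mk (fun q => μ * q ^ 4 / 4) (fun r => r ^ 4 / 4) γ).bondCurrent N i y) ∂((Literature.MathematicalPhysics.KineticTheory.HeatConduction.OscillatorChain.mk (fun q => μ * q ^ 4 / 4)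 (fun r => r ^ 4 / 4) γ).transitionKernel N T T (t).toNNReal z)) ∂((Literature.MathematicalPhysics.KineticTheory.HeatConduction.OscillatorChain.mk (fun q => μ * q ^ 4 / 4) (fun r => r ^ 4 / 4) γ).gibbsMeasure N T) := by
  sorry

/-! ## Abstract real analysis -/

/-- **The exchange lemma, abstract form.** Sequences `G N ν` (= `∫₀^∞e^{-νt}c_N`), `I N ν`
(= `∫₀^∞(1−e^{-νt})c_N`), `G0 N` (= `∫₀^∞ c_N`), a function `g` (= the ring Abel limit `K`) and numbers
`Tsq > 0`, `κ`: if `G0 N = G N ν + I N ν` (`ν > 0`), `(N−1)·Tsq·Dn N = G0 N`, the two-sided regularity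
estimate `∀ ε>0 ∃ ν₀>0 ∀ ν∈(0,ν₀) ∃ N₀ ∀ N≥N₀, |I N ν| ≤ εN`, the matching `G N ν / N → g ν` (`ν > 0`) and the
Abel limit `g → Tsq·κ` at `0⁺` hold, then `Dn → κ`. [folklore] -/
theorem tendsto_of_regularity_matching_abel (G I : ℕ → ℝ → ℝ) (G0 : ℕ → ℝ) (g : ℝ → ℝ) (Dn : ℕ → ℝ)
    (Tsq κ : ℝ) (hT : 0 < Tsq)
    (hsplit : ∀ ν : ℝ, 0 < ν → ∀ N : ℕ, G0 N = G N ν + I N ν)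
    (hK : ∀ N : ℕ, ((N : ℝ) - 1) * Tsq * Dn N = G0 N)
    (hR : ∀ ε : ℝ, 0 < ε → ∃ ν₀ : ℝ, 0 < ν₀ ∧ ∀ ν : ℝ, 0 < ν → ν < ν₀ → ∃ N₀ : ℕ, ∀ N : ℕ, N₀ ≤ N → |I N ν| ≤ ε * N)
    (hM : ∀ ν : ℝ, 0 < ν → Tendsto (fun N : ℕ => G N ν / N) atTop (𝓝 (g ν)))
    (hA : Tendsto g (𝓝[>] 0) (𝓝 (Tsq * κ))) :
    Tendsto Dn atTop (𝓝 κ) := by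
  -- step 1: `G0 N / N → Tsq κ` (an `ε/3` argument: choose `ν` small by `hA` and `hR`, then `N` large)
  have hu : Tendsto (fun N : ℕ => G0 N / N) atTop (𝓝 (Tsq * κ)) := by
    rw [Metric.tendsto_atTop]
    intro ε hε
    have hε3 : 0 < ε / 3 := by positivity
    obtain ⟨δ, hδ, hAδ⟩ := Metric.tendsto_nhdsWithin_nhds.1 hA (ε / 3) hε3
    obtain ⟨ν₀, hν₀, hRν⟩ := hR (ε / 3) hε3
    set ν : ℝ := min ν₀ δ / 2 with hνdef
    have hν : 0 < ν := by positivity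
    have hν1 : ν < ν₀ := by
      have : min ν₀ δ ≤ ν₀ := min_le_left _ _
      rw [hνdef]; linarith
    have hν2 : ν < δ := by
      have : min ν₀ δ ≤ δ := min_le_right _ _
      rw [hνdef]; linarith
    have hg : dist (g ν) (Tsq * κ) < ε / 3 :=
      hAδ (by exact hν) (by rwa [Real.dist_eq, sub_zero, abs_of_pos hν])
    obtain ⟨N₂, hN₂⟩ := hRν ν hν hν1
    obtain ⟨N₁, hN₁⟩ := (Metric.tendsto_atTop.1 (hM ν hν)) (ε / 3) hε3
    refine ⟨max (max N₁ N₂) 1, fun N hN => ?_⟩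
    have hN1 : N₁ ≤ N := le_trans (le_trans (le_max_left _ _) (le_max_left _ _)) hN
    have hN2 : N₂ ≤ N := le_trans (le_trans (le_max_right _ _) (le_max_left _ _)) hN
    have hNpos : (0 : ℝ) < N := by exact_mod_cast (le_trans (le_max_right _ _) hN)
    have h1 : dist (G N ν / N) (g ν) < ε / 3 := hN₁ N hN1
    have h2 : |I N ν| ≤ ε / 3 * N := hN₂ N hN2
    have h2' : |I N ν / N| ≤ ε / 3 := by
      rw [abs_div, abs_of_pos hNpos, div_le_iff₀ hNpos]
      exact h2
    rw [Real.dist_eq] at h1 hg ⊢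
    have e : G0 N / N - Tsq * κ = (G N ν / N - g ν) + I N ν / N + (g ν - Tsq * κ) := by
      rw [hsplit ν hν N]; ring
    rw [e]
    calc |G N ν / ↑N - g ν + I N ν / ↑N + (g ν - Tsq * κ)|
        ≤ |G N ν / ↑N - g ν + I N ν / ↑N| + |g ν - Tsq * κ| := abs_add_le _ _
      _ ≤ |G N ν / ↑N - g ν| + |I N ν / ↑N| + |g ν - Tsq * κ| := by
          linarith [abs_add_le (G N ν / ↑N - g ν) (I N ν / ↑N)]
      _ < ε / 3 + ε / 3 + ε / 3 := by linarith
      _ = ε := by ring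
  -- step 2: `Dn N = (G0 N / N) · (N / ((N−1) Tsq))` for `N ≥ 2`, and the second factor tends to `1/Tsq`
  have hfac : Tendsto (fun N : ℕ => (N : ℝ) / (((N : ℝ) - 1) * Tsq)) atTop (𝓝 (1 / Tsq)) := by
    have h1 : Tendsto (fun N : ℕ => (1 : ℝ) - 1 / (N : ℝ)) atTop (𝓝 (1 - 0)) :=
      tendsto_const_nhds.sub tendsto_one_div_atTop_nhds_zero_nat
    rw [sub_zero] at h1
    have h2 : Tendsto (fun N : ℕ => ((1 : ℝ) - 1 / (N : ℝ))⁻¹ * (1 / Tsq)) atTop (𝓝 (1⁻¹ * (1 / Tsq))) :=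
      (h1.inv₀ one_ne_zero).mul tendsto_const_nhds
    rw [inv_one, one_mul] at h2
    refine h2.congr' ?_
    filter_upwards [eventually_ge_atTop 2] with N hN
    have hN2 : (2 : ℝ) ≤ N := by exact_mod_cast hN
    have hN0 : (N : ℝ) ≠ 0 := by positivity
    have hN1 : (N : ℝ) - 1 ≠ 0 := by
      have : (0:ℝ) < (N:ℝ) - 1 := by linarith
      exact this.ne'
    field_simp
  have hprod := hu.mul hfac
  rw [show Tsq * κ * (1 / Tsq) = κ by field_simp] at hprod
  refine hprod.congr' ?_
  filter_upwards [eventually_ge_atTop 2] with N hN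
  have hN2 : (2 : ℝ) ≤ N := by exact_mod_cast hN
  have hN0 : (N : ℝ) ≠ 0 := by positivity
  have hN1 : (N : ℝ) - 1 ≠ 0 := by
    have : (0:ℝ) < (N:ℝ) - 1 := by linarith
    exact this.ne'
  rw [← hK N]
  field_simp

/-- Combining the two ONE-SIDED regularity estimates (no late excess, no late deficit) into the two-sided one.
[folklore] -/
theorem twoSided_of_oneSided (I : ℕ → ℝ → ℝ)
    (hE : ∀ η : ℝ, 0 < η → ∃ ε₀ : ℝ, 0 < ε₀ ∧ ∀ ε : ℝ, 0 < ε → ε < ε₀ → ∃ N₀ : ℕ, ∀ N : ℕ, N₀ ≤ N → I N ε ≤ η * N)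
    (hD : ∀ η : ℝ, 0 < η → ∃ ε₀ : ℝ, 0 < ε₀ ∧ ∀ ε : ℝ, 0 < ε → ε < ε₀ → ∃ N₀ : ℕ, ∀ N : ℕ, N₀ ≤ N → -(η * N) ≤ I N ε) :
    ∀ η : ℝ, 0 < η → ∃ ε₀ : ℝ, 0 < ε₀ ∧ ∀ ε : ℝ, 0 < ε → ε < ε₀ → ∃ N₀ : ℕ, ∀ N : ℕ, N₀ ≤ N → |I N ε| ≤ η * N := by
  intro η hη
  obtain ⟨ε₁, hε₁, h₁⟩ := hE η hη
  obtain ⟨ε₂, hε₂, h₂⟩ := hD η hη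
  refine ⟨min ε₁ ε₂, lt_min hε₁ hε₂, fun ε hε hεlt => ?_⟩
  obtain ⟨N₁, hN₁⟩ := h₁ ε hε (lt_of_lt_of_le hεlt (min_le_left _ _))
  obtain ⟨N₂, hN₂⟩ := h₂ ε hε (lt_of_lt_of_le hεlt (min_le_right _ _))
  refine ⟨max N₁ N₂, fun N hN => abs_le.2 ⟨?_, ?_⟩⟩
  · exact hN₂ N (le_trans (le_max_right _ _) hN)
  · exact hN₁ N (le_trans (le_max_left _ _) hN)

/-! ## The assembly -/

/-- **`AnchorKuboFourier` from its four regime pieces** `X1 = AnchorOpenKuboAbel`, `X2 = AnchorFixedFrequencyMatching`,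
`X3 = AnchorNoLateExcess`, `X4 = AnchorNoLateDeficit` (statements spelled out; see the module docstring).
[folklore] -/
theorem AnchorKuboFourier_of
    (hX1 : ∀ μ γ : ℝ, 0 < μ → 0 < γ → (∀ (N : ℕ) (T_L T_R : ℝ), 0 < T_L → 0 < T_R → ∀ ν ν' : MeasureTheory.Measure (Literature.MathematicalPhysics.KineticTheory.HeatConduction.PhaseSpace N), (Literature.MathematicalPhysics.KineticTheory.HeatConduction.OscillatorChain.mk (fun q => μ * q ^ 4 / 4) (fun r => r ^ 4 / 4) γ).IsSteadyState N T_L T_R ν → (Literature.MathematicalPhysics.KineticTheory.HeatConduction.OscillatorChain.mk (fun q => μ * q ^ 4 / 4) (fun r => r ^ 4 / 4) γ).IsSteadyState N T_L T_R ν' → ν = ν') → ∀ ν : (N : ℕ) → ℝ → ℝ → MeasureTheory.Measure (Literature.MathematicalPhysics.KineticTheory.HeatConduction.PhaseSpace N), (∀ (N : ℕ) (T_L T_R : ℝ), 0 < T_L → 0 < T_R → (Literature.MathematicalPhysics.KineticTheory.HeatConduction.OscillatorChain.mk (fun q => μ * q ^ 4 / 4) (fun r => r ^ 4 / 4) γ).IsSteadyState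 N T_L T_R (ν N T_L T_R)) → ∀ T : ℝ, 0 < T → ∀ (N : ℕ) (D : ℝ), Filter.Tendsto (fun δ : ℝ => (Literature.MathematicalPhysics.KineticTheory.HeatConduction.OscillatorChain.mk (fun q => μ * q ^ 4 / 4) (fun r => r ^ 4 / 4) γ).totalCurrent (ν N (T + δ / 2) (T - δ / 2)) / δ) (nhdsWithin 0 {(0 : ℝ)}ᶜ) (nhds D) → MeasureTheory.IntegrableOn (fun t : ℝ => ∫ z, (∑ i : Fin N, (Literature.MathematicalPhysics.KineticTheory.HeatConduction.OscillatorChain.mk (fun q => μ * q ^ 4 / 4) (fun r => r ^ 4 / 4) γ).bondCurrent N i z) * (∫ y, (∑ i : Fin N, (Literature.MathematicalPhysics.KineticTheory.HeatConduction.OscillatorChain.mk (fun q => μ * q ^ 4 / 4) (fun r => r ^ 4 / 4) γ).bondCurrent N i y) ∂((Literature.MathematicalPhysics.KineticTheory.HeatConduction.OscillatorChain.mk (fun q => μ * q ^ 4 / 4) (fun r => r ^ 4 / 4) γ).transitionKernel N T T (t).toNNReal z)) ∂((Literature.MathematicalPhysics.KineticTheory.HeatConduction.OscillatorChain.mk (fun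 q => μ * q ^ 4 / 4) (fun r => r ^ 4 / 4) γ).gibbsMeasure N T)) (Set.Ioi 0) ∧ ((N : ℝ) - 1) * T ^ 2 * D = ∫ t in Set.Ioi (0 : ℝ), ∫ z, (∑ i : Fin N, (Literature.MathematicalPhysics.KineticTheory.HeatConduction.OscillatorChain.mk (fun q => μ * q ^ 4 / 4) (fun r => r ^ 4 / 4) γ).bondCurrent N i z) * (∫ y, (∑ i : Fin N, (Literature.MathematicalPhysics.KineticTheory.HeatConduction.OscillatorChain.mk (fun q => μ * q ^ 4 / 4) (fun r => r ^ 4 / 4) γ).bondCurrent N i y) ∂((Literature.MathematicalPhysics.KineticTheory.HeatConduction.OscillatorChain.mk (fun q => μ * q ^ 4 / 4) (fun r => r ^ 4 / 4) γ).transitionKernel N T T (t).toNNReal z)) ∂((Literature.MathematicalPhysics.KineticTheory.HeatConduction.OscillatorChain.mk (fun q => μ * q ^ 4 / 4) (fun r => r ^ 4 / 4) γ).gibbsMeasure N T))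
    (hX2 : ∀ (μ γ T : ℝ), 0 < μ → 0 < γ → 0 < T → ∀ H : (N : ℕ) → Literature.MathematicalPhysics.KineticTheory.HeatConduction.PhaseSpace N → ℝ, (∀ N : ℕ, H N = fun x : Literature.MathematicalPhysics.KineticTheory.HeatConduction.PhaseSpace N => (Literature.MathematicalPhysics.KineticTheory.HeatConduction.OscillatorChain.mk (fun q => μ * q ^ 4 / 4) (fun r => r ^ 4 / 4) 0).hamiltonian N x + ∑ i : Fin N, ∑ j : Fin N, if i.val + 1 = N ∧ j.val = 0 ∧ 2 < N then (x.1 j - x.1 i) ^ 4 / 4 else 0) → ∀ J : (N : ℕ) → Literature.MathematicalPhysics.KineticTheory.HeatConduction.PhaseSpace N → ℝ, (∀ N : ℕ, J N = fun x : Literature.MathematicalPhysics.KineticTheory.HeatConduction.PhaseSpace N => (∑ i : Fin N, (Literature.MathematicalPhysics.KineticTheory.HeatConduction.OscillatorChain.mk (fun q => μ * q ^ 4 / 4) (fun r => r ^ 4 / 4) 0).bondCurrent N i x) + ∑ i : Fin N, ∑ j : Fin N, if i.val + 1 = N ∧ j.val = 0 ∧ 2 < N then -((x.2 i + x.2 j)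 / 2 * (x.1 j - x.1 i) ^ 3) else 0) → ∀ Φ : (N : ℕ) → ℝ → Literature.MathematicalPhysics.KineticTheory.HeatConduction.PhaseSpace N → Literature.MathematicalPhysics.KineticTheory.HeatConduction.PhaseSpace N, (∀ N : ℕ, Literature.MathematicalPhysics.KineticTheory.NewtonianFlow.IsFlow (fun (q : Fin N → ℝ) (i : Fin N) => -Literature.MathematicalPhysics.KineticTheory.HeatConduction.partialQ i (H N) (q, fun _ => 0)) (Φ N)) → ∀ ε : ℝ, 0 < ε → Filter.Tendsto (fun N : ℕ => (N : ℝ)⁻¹ * ((∫ t in Set.Ioi (0 : ℝ), Real.exp (-(ε * t)) * ∫ z, (∑ i : Fin N, (Literature.MathematicalPhysics.KineticTheory.HeatConduction.OscillatorChain.mk (fun q => μ * q ^ 4 / 4) (fun r => r ^ 4 / 4) γ).bondCurrent N i z) * (∫ y, (∑ i : Fin N, (Literature.MathematicalPhysics.KineticTheory.HeatConduction.OscillatorChain.mk (fun q => μ * q ^ 4 / 4) (fun r => r ^ 4 / 4) γ).bondCurrent N i y) ∂((Literature.MathematicalPhysics.KineticTheory.HeatConduction.OscillatorChain.mk (fun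 q => μ * q ^ 4 / 4) (fun r => r ^ 4 / 4) γ).transitionKernel N T T (t).toNNReal z)) ∂((Literature.MathematicalPhysics.KineticTheory.HeatConduction.OscillatorChain.mk (fun q => μ * q ^ 4 / 4) (fun r => r ^ 4 / 4) γ).gibbsMeasure N T)) - ∫ t in Set.Ioi (0 : ℝ), Real.exp (-(ε * t)) * ∫ x, J N (Φ N t x) * J N x ∂((MeasureTheory.volume : MeasureTheory.Measure (Literature.MathematicalPhysics.KineticTheory.HeatConduction.PhaseSpace N)).tilted (fun x => -(H N) x / T)))) Filter.atTop (nhds 0))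
    (hX3 : ∀ (μ γ T : ℝ), 0 < μ → 0 < γ → 0 < T → ∀ η : ℝ, 0 < η → ∃ ε₀ : ℝ, 0 < ε₀ ∧ ∀ ε : ℝ, 0 < ε → ε < ε₀ → ∃ N₀ : ℕ, ∀ N : ℕ, N₀ ≤ N → (∫ t in Set.Ioi (0 : ℝ), (1 - Real.exp (-(ε * t))) * ∫ z, (∑ i : Fin N, (Literature.MathematicalPhysics.KineticTheory.HeatConduction.OscillatorChain.mk (fun q => μ * q ^ 4 / 4) (fun r => r ^ 4 / 4) γ).bondCurrent N i z) * (∫ y, (∑ i : Fin N, (Literature.MathematicalPhysics.KineticTheory.HeatConduction.OscillatorChain.mk (fun q => μ * q ^ 4 / 4) (fun r => r ^ 4 / 4) γ).bondCurrent N i y) ∂((Literature.MathematicalPhysics.KineticTheory.HeatConduction.OscillatorChain.mk (fun q => μ * q ^ 4 / 4) (fun r => r ^ 4 / 4) γ).transitionKernel N T T (t).toNNReal z)) ∂((Literature.MathematicalPhysics.KineticTheory.HeatConduction.OscillatorChain.mk (fun q => μ * q ^ 4 / 4) (fun r => r ^ 4 / 4) γ).gibbsMeasure N T)) ≤ η *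 N)
    (hX4 : ∀ (μ γ T : ℝ), 0 < μ → 0 < γ → 0 < T → ∀ η : ℝ, 0 < η → ∃ ε₀ : ℝ, 0 < ε₀ ∧ ∀ ε : ℝ, 0 < ε → ε < ε₀ → ∃ N₀ : ℕ, ∀ N : ℕ, N₀ ≤ N → -(η * N) ≤ ∫ t in Set.Ioi (0 : ℝ), (1 - Real.exp (-(ε * t))) * ∫ z, (∑ i : Fin N, (Literature.MathematicalPhysics.KineticTheory.HeatConduction.OscillatorChain.mk (fun q => μ * q ^ 4 / 4) (fun r => r ^ 4 / 4) γ).bondCurrent N i z) * (∫ y, (∑ i : Fin N, (Literature.MathematicalPhysics.KineticTheory.HeatConduction.OscillatorChain.mk (fun q => μ * q ^ 4 / 4) (fun r => r ^ 4 / 4) γ).bondCurrent N i y) ∂((Literature.MathematicalPhysics.KineticTheory.HeatConduction.OscillatorChain.mk (fun q => μ * q ^ 4 / 4) (fun r => r ^ 4 / 4) γ).transitionKernel N T T (t).toNNReal z)) ∂((Literature.MathematicalPhysics.KineticTheory.HeatConduction.OscillatorChain.mk (fun q => μ * q ^ 4 / 4) (fun r => r ^ 4 / 4) γ).gibbsMeasure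 N T)) :
    Summit.AtomisticToContinuum.FouriersLaw.Theses.AffineAnchorRing.AnchorKuboFourier := by
  intro μ γ T k hμ hγ hT H hH J hJ Φ hΦ hGK hUniq ν hν Dn hDn
  obtain ⟨K, hKlim, hK0⟩ := hGK
  -- the open-chain equilibrium current autocorrelation and its three Abel functionals
  let c : ℕ → ℝ → ℝ := fun N t =>
    ∫ z, (∑ i : Fin N, (Literature.MathematicalPhysics.KineticTheory.HeatConduction.OscillatorChain.mk (fun q => μ * q ^ 4 / 4) (fun r => r ^ 4 / 4) γ).bondCurrent N i z) *
      (∫ y, (∑ i : Fin N, (Literature.MathematicalPhysics.KineticTheory.HeatConduction.OscillatorChain.mk (fun q => μ * q ^ 4 / 4) (fun r => r ^ 4 / 4) γ).bondCurrent N i y) ∂((Literature.MathematicalPhysics.KineticTheory.HeatConduction.OscillatorChain.mk (fun q => μ * q ^ 4 / 4) (fun r => r ^ 4 / 4) γ).transitionKernel N T T (t).toNNReal z))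
      ∂((Literature.MathematicalPhysics.KineticTheory.HeatConduction.OscillatorChain.mk (fun q => μ * q ^ 4 / 4) (fun r => r ^ 4 / 4) γ).gibbsMeasure N T)
  let G : ℕ → ℝ → ℝ := fun N ε => ∫ t in Set.Ioi (0 : ℝ), Real.exp (-(ε * t)) * c N t
  let I : ℕ → ℝ → ℝ := fun N ε => ∫ t in Set.Ioi (0 : ℝ), (1 - Real.exp (-(ε * t))) * c N t
  let G0 : ℕ → ℝ := fun N => ∫ t in Set.Ioi (0 : ℝ), c N t
  -- the ring Abel functional of the crux's hypothesis
  let R : ℕ → ℝ → ℝ := fun N ε => ∫ t in Set.Ioi (0 : ℝ), Real.exp (-(ε * t)) *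
    ∫ x, J N (Φ N t x) * J N x ∂((MeasureTheory.volume : MeasureTheory.Measure (Literature.MathematicalPhysics.KineticTheory.HeatConduction.PhaseSpace N)).tilted (fun x => -(H N) x / T))
  -- X1: integrability and the Kubo–Abel identity at every `N`
  have hKN : ∀ N : ℕ, MeasureTheory.IntegrableOn (c N) (Set.Ioi 0) ∧ ((N : ℝ) - 1) * T ^ 2 * Dn N = G0 N :=
    fun N => hX1 μ γ hμ hγ hUniq ν hν T hT N (Dn N) (hDn N)
  -- the split `G0 = G + I` (linearity; both pieces integrable by domination)
  have hsplit : ∀ ε : ℝ, 0 < ε → ∀ N : ℕ, G0 N = G N ε + I N ε := by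
    intro ε hε N
    have hint : MeasureTheory.Integrable (c N) (MeasureTheory.volume.restrict (Set.Ioi (0 : ℝ))) := (hKN N).1
    have hmeas : MeasureTheory.AEStronglyMeasurable (fun t : ℝ => Real.exp (-(ε * t)))
        (MeasureTheory.volume.restrict (Set.Ioi (0 : ℝ))) :=
      (Real.continuous_exp.comp (continuous_const.mul continuous_id).neg).aestronglyMeasurable
    have hmeas' : MeasureTheory.AEStronglyMeasurable (fun t : ℝ => 1 - Real.exp (-(ε * t)))
        (MeasureTheory.volume.restrict (Set.Ioi (0 : ℝ))) :=
      (continuous_const.sub (Real.continuous_exp.comp (continuous_const.mul continuous_id).neg)).aestronglyMeasurable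
    have hb1 : ∀ᵐ t ∂(MeasureTheory.volume.restrict (Set.Ioi (0 : ℝ))), ‖Real.exp (-(ε * t))‖ ≤ 1 := by
      filter_upwards [MeasureTheory.ae_restrict_mem measurableSet_Ioi] with t ht
      rw [Real.norm_eq_abs, abs_of_pos (Real.exp_pos _)]
      exact Real.exp_le_one_iff.2 (by nlinarith [le_of_lt (show (0:ℝ) < t from ht)])
    have hb2 : ∀ᵐ t ∂(MeasureTheory.volume.restrict (Set.Ioi (0 : ℝ))), ‖1 - Real.exp (-(ε * t))‖ ≤ 1 := by
      filter_upwards [MeasureTheory.ae_restrict_mem measurableSet_Ioi] with t ht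
      have h1 : Real.exp (-(ε * t)) ≤ 1 := Real.exp_le_one_iff.2 (by nlinarith [le_of_lt (show (0:ℝ) < t from ht)])
      have h2 : 0 < Real.exp (-(ε * t)) := Real.exp_pos _
      rw [Real.norm_eq_abs, abs_of_nonneg (by linarith)]
      linarith
    have hiG : MeasureTheory.Integrable (fun t : ℝ => Real.exp (-(ε * t)) * c N t)
        (MeasureTheory.volume.restrict (Set.Ioi (0 : ℝ))) := hint.bdd_mul hmeas hb1
    have hiI : MeasureTheory.Integrable (fun t : ℝ => (1 - Real.exp (-(ε * t))) * c N t)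
        (MeasureTheory.volume.restrict (Set.Ioi (0 : ℝ))) := hint.bdd_mul hmeas' hb2
    have hsum := MeasureTheory.integral_add hiG hiI
    have hfun : (fun t : ℝ => Real.exp (-(ε * t)) * c N t + (1 - Real.exp (-(ε * t))) * c N t) = c N := by
      funext t; ring
    rw [hfun] at hsum
    exact hsum
  -- X3 ∧ X4: the two-sided regularity estimate
  have hR : ∀ η : ℝ, 0 < η → ∃ ε₀ : ℝ, 0 < ε₀ ∧ ∀ ε : ℝ, 0 < ε → ε < ε₀ →
      ∃ N₀ : ℕ, ∀ N : ℕ, N₀ ≤ N → |I N ε| ≤ η * N :=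
    twoSided_of_oneSided I (hX3 μ γ T hμ hγ hT) (hX4 μ γ T hμ hγ hT)
  -- X2 + the crux's ring Green–Kubo hypothesis: `G N ε / N → K ε`
  have hM : ∀ ε : ℝ, 0 < ε → Tendsto (fun N : ℕ => G N ε / N) atTop (𝓝 (K ε)) := by
    intro ε hε
    have h1 : Tendsto (fun N : ℕ => (N : ℝ)⁻¹ * R N ε) atTop (𝓝 (K ε)) := hKlim ε hε
    have h2 : Tendsto (fun N : ℕ => (N : ℝ)⁻¹ * (G N ε - R N ε)) atTop (𝓝 0) :=
      hX2 μ γ T hμ hγ hT H hH J hJ Φ hΦ ε hε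
    have h3 := h1.add h2
    rw [add_zero] at h3
    refine h3.congr' (Filter.Eventually.of_forall fun N => ?_)
    show (N : ℝ)⁻¹ * R N ε + (N : ℝ)⁻¹ * (G N ε - R N ε) = G N ε / N
    ring
  -- the Abel limit of the crux's hypothesis, in the normalisation of the lemma
  have hA : Tendsto K (𝓝[>] 0) (𝓝 (T ^ 2 * (k / T ^ 2))) := by
    have hT2 : T ^ 2 ≠ 0 := pow_ne_zero 2 hT.ne'
    rw [mul_div_cancel₀ k hT2]
    exact hK0
  exact tendsto_of_regularity_matching_abel G I G0 K Dn (T ^ 2) (k / T ^ 2) (pow_pos hT 2)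
    hsplit (fun N => (hKN N).2) hR hM hA


/-- The crux from the four registered stubs (kernel-checked composition; the only sorries are inside the stubs). [folklore] -/
theorem anchorKuboFourier_of_stubs :
    Summit.AtomisticToContinuum.FouriersLaw.Theses.AffineAnchorRing.AnchorKuboFourier :=
  AnchorKuboFourier_of stub_anchorOpenKuboAbel stub_anchorFixedFrequencyMatching stub_anchorNoLateExcess
    stub_anchorNoLateDeficit

end Summit.AtomisticToContinuum.FouriersLaw.Cruxes.AnchorKuboFourier.RegimeSplit
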